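import Summits.BirchSwinnertonDyer.BirchSwinnertonDyer.Theorems.KolyvaginRoadThreeMethod2ChebTarget
import Summits.BirchSwinnertonDyer.BirchSwinnertonDyer.Theorems.KolyvaginRoadThreeMethod2LocalFrobenius
import Literature.NumberTheory.Automorphic.ChebotarevArtinRepHolds
import HarnessLib

/-!
# Method 2 at `p = 3` — (Cheb) II: Čebotarev with the sign at `p = 3`

Sub-problem `BirchSwinnertonDyer`, route `KolyvaginRoadThree`, METHOD line on the crux `ZhangSharpFrameAtThreeHL`
(`stmt-BirchSwinnertonDyer-19574`), stub A `stub_levelRaisingAtThree`, input (Cheb) of koly3a's reduction.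

`exists_uAdmissible_loc_ne_zero` — **Čebotarev with the sign** (koly MEMO-v8 §4; W. Zhang 2014 Lemma 7.3 and
Bertolini–Darmon 2005 Thm. 3.2 at `p = 3`).  On the frame (`K` imaginary quadratic, `ρ̄_{E,3}` onto, `3` multiplicative,
Heegner hypothesis), for a non-zero class `x ∈ H¹(K, E[3])` with `c_* x = ν x` (`ν = ±1`) and any finite set `B₀`
of naturals, there is a unipotent-admissible prime `q ∉ B₀` (`q ∤ 3 N_E d_K` prime, inert in `K`, `q ≡ 1 (mod 3)`,
`3 ∤ a_q`) with `Frob_q² ≠ 1` on `E[3]` and `loc_v x ≠ 0` at the place `v ∣ q` of `K`.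

Proof (the template is the tree's `exists_kolyvaginPrime_gt`, McCallum Prop. 3.1 / Cor. 3.2, with a different
Frobenius class).  Step A: the lift `t` of `c` and the unipotent target `g₁`, `N'` of `exists_unipotent_target`
(`c₀ · res g₁` acts on `E[3]` as `ν(1 + N')`).  Step B: `E(K̄)[3]` is simple with scalar commutant and `−1 ∈ ρ̄(Γ_K)`
(`KolyvaginImage`, from `Surj`), so by Gross Prop. 9.3 (`exists_h1Eval_eq`) the cocycle `ξ` of `x` takes a prescribed
value `y = κ₀ − Q₁` at some `ρ ∈ Γ_{K(E[3])}`, where `κ₀ = ξ(t⁻¹ g₁ t · g₁)` and `N' Q₁ ≠ 0`.  Steps C–D: Čebotarev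
(`absoluteGaloisGroup.frobenius_dense`, from the PROVED `chebotarev_artinRep_holds`) gives an arithmetic Frobenius
`γ = c₀ · res(g₁ ρ m)` (`m` in the open subgroup on which `ξ` vanishes) at a prime `𝔓₀ ∣ v` of `\bar ℤ` outside a
finite bad set.  Steps E–F: the prime `ℓ` below is inert with `Frob_w = τ' = (t⁻¹ g t) g` over `K`, `g = g₁ ρ m`
(`exists_place_inert_of_not_mem_range`, `sq_eq_absGaloisRestrict_conjGal_mul`).  Step G: THE SIGN COMPUTATION —
`ξ(τ') = κ₀ + (ν Γ + Γ²) y` with `Γ = T ∘ g₁ = ν(1 + N')`, and `ν Γ + Γ² = (1 + N') + (1 + 2N') ≡ −1`, so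
`ξ(τ') = κ₀ − y = Q₁ ∉ (τ' − 1) E[3] = N' E[3]`; by Gross Prop. 9.6 at the non-trivial Frobenius (zhang3-p1's
`LocalFrob.oneCocycleClass_mem_torsionLocalKer_iff_apply_frob`, after conjugating `τ'` to the prime cut out by the
chosen embedding) `loc_w x ≠ 0`.  Step H: `ℓ` is unipotent-admissible (`mod_three_and_trace_of_frob`) with
`Frob_ℓ² = 1 + 2N' ≠ 1`.

References: [cite: WZhang2014, Lemma 7.3] [cite: BertoliniDarmon2005, Thm. 3.2] [cite: GrossLMS1991, Prop. 9.3, 9.6]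
[cite: McCallumLMS1991, §3 Prop. 3.1, Cor. 3.2] [cite: TateGCFT1967, §2.4].
-/

noncomputable section

open scoped Classical Pointwise
open Polynomial

namespace Summit.BirchSwinnertonDyer.Rank1Residual.X11b.Three.Koly.Method2.Cheb

open WeierstrassCurve Field Function NumberField IsDedekindDomain Rat.HeightOneSpectrum
open Literature.NumberTheory.EllipticCurves Literature.NumberTheory.GaloisRepresentations Module
open Summit.BirchSwinnertonDyer.BirchSwinnertonDyer.Theorems

section Main

variable (W : WeierstrassCurve ℚ) (K : Type) [Field K] [NumberField K] [W.IsElliptic] [W.IsGloballyMinimal]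

set_option maxHeartbeats 400000 in
/-- **Čebotarev with the sign at `p = 3`** (koly MEMO-v8 §4; Zhang 2014 Lemma 7.3 / Bertolini–Darmon 2005 Thm. 3.2).
For `E = W/ℚ` in global minimal form with `ρ̄_{E,3}` onto and multiplicative reduction at `3`, `K` imaginary quadratic
satisfying the Heegner hypothesis for `N_E`, its complex conjugation `c ≠ 1`, a sign `ν = ±1`, a non-zero class
`x ∈ H¹(K, E[3])` with `c_* x = ν x`, and a finite set `B₀ ⊂ ℕ`: there is a unipotent-admissible prime `q ∉ B₀`
(`IsUAdmissiblePrime W K q`) with `Frob_q² ≠ 1` on `E[3]` (`FrobSqNeOneAt W 3 q`) and a place `v ∋ q` of `K` at which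
the localisation of `x` in `H¹(K_v, E[3])` is non-zero.  Proof in the module docstring.
[cite: WZhang2014, Lemma 7.3] [cite: BertoliniDarmon2005, Thm. 3.2] [cite: GrossLMS1991, Prop. 9.3, 9.6] -/
theorem exists_uAdmissible_loc_ne_zero (hK : IsImaginaryQuadratic K)
    (hsurj : Literature.NumberTheory.EllipticCurves.Rank1Residual.Surj W 3)
    (hmult : W.HasMultiplicativeReductionAtPrime 3) (hH : SatisfiesHeegnerHypothesis (W.conductorNorm ℤ) K)
    {c : K ≃ₐ[ℚ] K} (hc1 : c ≠ 1) {ν : ℤ} (hν : ν = 1 ∨ ν = -1)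
    {x : galH1Torsion (W.baseChange K) ((3 : ℕ) : ℤ)} (hx0 : x ≠ 0)
    (hxν : conjAct W c ((3 : ℕ) : ℤ) x = ν • x) (B₀ : Finset ℕ) :
    ∃ q : ℕ, q ∉ B₀ ∧ IsUAdmissiblePrime W K q ∧ FrobSqNeOneAt W 3 q ∧
      ∃ v : HeightOneSpectrum (𝓞 K), (q : 𝓞 K) ∈ v.asIdeal ∧
        x ∉ (W.baseChange K).torsionLocalKer (v.adicCompletion K) ((3 : ℕ) : ℤ) := by
  classical
  haveI : Fact (Nat.Prime 3) := ⟨Nat.prime_three⟩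
  haveI : Algebra.IsQuadraticExtension ℚ K := ⟨hK.1⟩
  haveI : IsTotallyComplex K := hK.2
  have hn0 : ((3 : ℕ) : ℤ) ≠ 0 := by norm_num
  have hνν : ν * ν = 1 := by rcases hν with rfl | rfl <;> norm_num
  -- ### Step A: complex conjugation, the involutive lift, the unipotent target
  obtain ⟨c₀, hc₀⟩ := exists_isComplexConjugation (Rat.castHom ℝ)
  set t : AlgebraicClosure K ≃+* AlgebraicClosure K :=
    (absGaloisTransport (K := ℚ) (L := K) c₀).toRingEquiv with ht_def
  have ht : IsLiftOfAut c t :=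
    RatClosure.isLiftOfAut_absGaloisTransport_of_isImaginaryQuadratic hK hc1 hc₀
  have hinv : ∀ x, t (t x) = x := fun x ↦
    RatClosure.absGaloisTransport_absGaloisTransport_of_sq_eq_one hc₀.sq_eq_one x
  obtain ⟨g₁, N', hN'N', ⟨Q₁, hQ₁⟩, hG, hγ₁⟩ := exists_unipotent_target W K hK hsurj hmult hH ht hinv hν
  set θ := RatClosure.torsionEquiv (K := K) W ((3 : ℕ) : ℤ) with hθ
  set T := ht.torsionMap W ((3 : ℕ) : ℤ) with hTdef
  have hTT : ∀ Q, T (T Q) = Q := ht.torsionMap_torsionMap W hinv ((3 : ℕ) : ℤ)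
  have hconj : ∀ (g : absoluteGaloisGroup K) (X : geomTorsion (W.baseChange K) ((3 : ℕ) : ℤ)),
      ht.conjGalCMH g • X = T (g • T X) := fun g X ↦ by
    rw [← hTT (ht.conjGalCMH g • X), hTdef, ht.torsionMap_smul W ((3 : ℕ) : ℤ)]
  have h3tor : ∀ X : geomTorsion (W.baseChange K) ((3 : ℕ) : ℤ), (3 : ℤ) • X = 0 := fun X ↦
    Subtype.ext ((mem_geomTorsion_iff (W.baseChange K) _ _).mp X.2)
  -- the action of `g₁` and of `conj(g₁) g₁` through `T`
  have hA2 : ∀ X : geomTorsion (W.baseChange K) ((3 : ℕ) : ℤ),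
      T (g₁ • T (g₁ • X)) = X + N' X + N' X := fun X ↦ by
    rw [hG, hG, map_zsmul, map_add, hN'N', add_zero, smul_add, smul_smul, hνν, one_smul, smul_smul, hνν,
      one_smul]
  -- ### Step B: the module `E(K̄)[3]` (simple, scalar commutant, `-1`, `2⁻¹`) and Prop. 9.3
  have hT3 : ∀ P : geomTorsion (W.baseChange K) ((3 : ℕ) : ℤ), 3 • P = 0 := fun P ↦ by
    rw [← natCast_zsmul]; exact h3tor P
  have hcard : Nat.card (geomTorsion (W.baseChange K) ((3 : ℕ) : ℤ)) = 3 ^ 2 :=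
    card_torsionPoints_eq_sq_holds (W.baseChange K) (AlgebraicClosure K) (n := 3) (by norm_num)
  obtain ⟨eT⟩ := KolyvaginImage.nonempty_addEquiv_of_card_eq_sq (p := 3) hT3 hcard
  have hsq := RatClosure.exists_smul_eq_of_sq (K := K) W hK.1 (n := ((3 : ℕ) : ℤ)) hsurj
  obtain ⟨z, hz⟩ := KolyvaginImage.exists_smul_eq_neg eT hsq
  have hS := KolyvaginImage.eq_bot_or_eq_top eT hsq (by norm_num)
  have hCe := KolyvaginImage.exists_eq_zsmul eT hsq (by norm_num)
  obtain ⟨u, hu⟩ := KolyvaginImage.exists_two_mul_zsmul_eq eT (p := 3) (by norm_num)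
  -- the cocycle of `x` (as a `E(K̄)[3]`-valued function `ξ`), the constant `κ₀`, the target value `y`, and `ρ`
  set φ := reprCocycle (W.baseChange K) ((3 : ℕ) : ℤ) x with hφdef
  have hclass : oneCocycleClass _ φ = x := oneCocycleClass_reprCocycle (W.baseChange K) _ x
  set ξ : absoluteGaloisGroup K → geomTorsion (W.baseChange K) ((3 : ℕ) : ℤ) := fun a ↦ φ.1 a with hξ
  have hcoc : ∀ a b : absoluteGaloisGroup K, ξ (a * b) = ξ a + a • ξ b := fun a b ↦ by
    have := φ.2 a b
    rw [discreteTopRep_ρ_apply] at this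
    exact this
  have hξinv : ∀ a : absoluteGaloisGroup K, ξ a⁻¹ = -(a⁻¹ • ξ a) := fun a ↦ cocycle_apply_inv (W.baseChange K) _ φ a
  obtain ⟨κ₀, hκ₀⟩ : ∃ κ₀ : geomTorsion (W.baseChange K) ((3 : ℕ) : ℤ), ξ (ht.conjGalCMH g₁ * g₁) = κ₀ := ⟨_, rfl⟩
  obtain ⟨y, hy⟩ : ∃ y : geomTorsion (W.baseChange K) ((3 : ℕ) : ℤ), κ₀ - Q₁ = y := ⟨_, rfl⟩
  have hind : ∀ a : Fin 1 → ℤ, ∑ i, a i • (![x] : Fin 1 → _) i = 0 → ∀ i, (3 : ℤ) ∣ a i := by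
    intro a ha i
    have hi : i = 0 := Subsingleton.elim i 0
    subst hi
    simp only [Finset.univ_unique, Fin.default_eq_zero, Fin.isValue, Matrix.cons_val_zero,
      Finset.sum_singleton] at ha
    by_contra h3
    exact hx0 (eq_zero_of_zsmul_eq_zero_of_not_dvd' Nat.prime_three
      (fun x' ↦ zsmul_galH1Torsion_eq_zero (W.baseChange K) _ x') h3 ha)
  obtain ⟨ρ, hρT, hρ⟩ := exists_h1Eval_eq (W.baseChange K) Nat.prime_three hS hCe hz hu ![x] hind ![y]
  have hρy : ξ ρ = y := by
    have h := hρ 0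
    simp only [Matrix.cons_val_zero] at h
    exact h
  -- ### Step C: the finite exceptional set of places of `ℚ`
  have hbad : ((W.baseChange K).badPlaces (𝓞 K)).Finite := (W.baseChange K).finite_badPlaces_holds (𝓞 K)
  obtain ⟨Tx, hTxfin, hTx⟩ := exists_finite_forall_mem_unramifiedKer (W.baseChange K) (n := ((3 : ℕ) : ℤ)) hn0 x
  set B : Finset ℕ := {3} ∪ (W.conductorNorm ℤ).primeFactors ∪ (NumberField.discr K).natAbs.primeFactors ∪ B₀ with hB
  set S₁ : Set (HeightOneSpectrum (𝓞 ℚ)) := {v | ∃ q ∈ B, q.Prime ∧ (q : 𝓞 ℚ) ∈ v.asIdeal} with hS₁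
  set S₂ : Set (HeightOneSpectrum (𝓞 ℚ)) := {v | ¬ Algebra.IsUnramifiedIn (𝓞 K) v.asIdeal} with hS₂
  set S₃ : Set (HeightOneSpectrum (𝓞 ℚ)) :=
    (fun w : HeightOneSpectrum (𝓞 K) ↦ w.under (𝓞 ℚ)) '' ((W.baseChange K).badPlaces (𝓞 K) ∪ Tx) with hS₃
  have hS₁fin : S₁.Finite := by
    have : S₁ ⊆ ⋃ q ∈ (B.filter Nat.Prime), {v | (q : 𝓞 ℚ) ∈ v.asIdeal} := by
      intro v ⟨q, hqB, hq, hqv⟩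
      simp only [Set.mem_iUnion, Finset.mem_filter]
      exact ⟨q, ⟨hqB, hq⟩, hqv⟩
    refine Set.Finite.subset (Set.Finite.biUnion (Finset.finite_toSet _) fun q hq ↦ ?_) this
    rw [Finset.coe_filter, Set.mem_setOf_eq] at hq
    have hsub : {v : HeightOneSpectrum (𝓞 ℚ) | (q : 𝓞 ℚ) ∈ v.asIdeal}.Subsingleton :=
      fun v hv v' hv' ↦ HeightOneSpectrum.eq_of_natCast_mem_rat hq.2 hv hv'
    exact hsub.finite
  have hS₂fin : S₂.Finite := finite_setOf_not_isUnramifiedIn ℚ K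
  have hS₃fin : S₃.Finite := (hbad.union hTxfin).image _
  set S := S₁ ∪ S₂ ∪ S₃ with hSdef
  have hSfin : S.Finite := (hS₁fin.union hS₂fin).union hS₃fin
  -- ### Step D: Čebotarev in `Γ_ℚ`: a Frobenius in the open set `c₀ · res(g₁ ρ 𝒩)`
  set 𝒩 := evalKer (W.baseChange K) ((3 : ℕ) : ℤ) ![x] with h𝒩
  have h𝒩open : IsOpen (𝒩 : Set (absoluteGaloisGroup K)) :=
    isOpen_evalKer (W.baseChange K) _ ![x] (isOpen_torsionFixing (W.baseChange K) hn0)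
  set O : Set (absoluteGaloisGroup ℚ) :=
    (fun γ ↦ c₀ * γ) '' (absGaloisRestrict ℚ K '' ((fun m ↦ (g₁ * ρ) * m) '' (𝒩 : Set _))) with hO
  have hOopen : IsOpen O := by
    refine (Homeomorph.mulLeft c₀).isOpenMap _ (isOpenMap_absGaloisRestrict K _ ?_)
    exact (Homeomorph.mulLeft (g₁ * ρ)).isOpenMap _ h𝒩open
  have hOne : O.Nonempty :=
    ⟨c₀ * absGaloisRestrict ℚ K ((g₁ * ρ) * 1), _, ⟨_, ⟨1, 𝒩.one_mem, rfl⟩, rfl⟩, rfl⟩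
  obtain ⟨γ, hγO, v, hvS, 𝔓₀, h𝔓₀, hγ⟩ :=
    (absoluteGaloisGroup.frobenius_dense Literature.NumberTheory.Automorphic.chebotarev_artinRep_holds ℚ S hSfin).inter_open_nonempty
      O hOopen hOne
  obtain ⟨_, ⟨_, ⟨m, hm, rfl⟩, rfl⟩, rfl⟩ := hγO
  set s := ρ * m with hs
  set g := g₁ * s with hg
  have hgeq : g₁ * ρ * m = g := by rw [hg, hs, mul_assoc]
  have hsT : s ∈ torsionFixing (W.baseChange K) ((3 : ℕ) : ℤ) := mul_mem hρT hm.1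
  dsimp only at hγ
  rw [hgeq] at hγ
  -- ### Step E: the rational prime `ℓ` under `v`
  obtain ⟨ℓ, hℓ, hℓv⟩ := exists_prime_natCast_mem v
  have hℓB : ℓ ∉ B := fun h ↦ hvS (Or.inl (Or.inl ⟨ℓ, h, hℓ, hℓv⟩))
  simp only [hB, Finset.mem_union, Finset.mem_singleton, Nat.mem_primeFactors, not_or] at hℓB
  obtain ⟨⟨⟨hℓ3, hℓN⟩, hℓD⟩, hℓB₀⟩ := hℓB
  have hℓN' : ¬ ℓ ∣ W.conductorNorm ℤ := fun h ↦ hℓN ⟨hℓ, h, (W.conductorNorm_pos_holds).ne'⟩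
  have hℓD' : ¬ ((ℓ : ℤ) ∣ NumberField.discr K) := fun h ↦
    hℓD ⟨hℓ, Int.natAbs_dvd_natAbs.mpr h |>.trans (by simp), by simp [NumberField.discr_ne_zero]⟩
  have hunr : Algebra.IsUnramifiedIn (𝓞 K) v.asIdeal := by
    by_contra h; exact hvS (Or.inl (Or.inr h))
  have hvS₃ : v ∉ S₃ := fun h ↦ hvS (Or.inr h)
  haveI : Fact ℓ.Prime := ⟨hℓ⟩
  have hℓ3' : ℓ ≠ 3 := hℓ3
  have hgoodℓ : W.HasGoodReductionAtPrime ℓ := by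
    by_contra hbadℓ
    exact hℓN' ((W.dvd_conductorNorm_iff_not_hasGoodReductionAtPrime ℓ).mpr hbadℓ)
  have hvℓ : (primesEquiv v : ℕ) = ℓ := primesEquiv_eq_of_natCast_mem hℓ hℓv
  -- ### Step F: `ℓ` is inert, with a Frobenius `τ' = conj(g) g` over `K`
  have hHi := index_range_absGaloisRestrict_eq_finrank ℚ K
  haveI hHn : ((absGaloisRestrict ℚ K).range).Normal :=
    Subgroup.normal_of_index_eq_two (hHi.trans hK.1)
  have hI := inertia_le_range_absGaloisRestrict_of_isUnramifiedIn (K := K) hunr h𝔓₀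
  have hΦH : c₀ * absGaloisRestrict ℚ K g ∉ (absGaloisRestrict ℚ K).range := by
    intro h
    apply hc₀.not_mem_range_absGaloisRestrict (L := K) IsTotallyComplex.isComplex
    change c₀ ∈ ((absGaloisRestrict ℚ K).range : Set (absoluteGaloisGroup ℚ))
    have h' : c₀ = c₀ * absGaloisRestrict ℚ K g * (absGaloisRestrict ℚ K g)⁻¹ := by group
    rw [SetLike.mem_coe, h']
    exact Subgroup.mul_mem _ h (Subgroup.inv_mem _ ⟨g, rfl⟩)
  obtain ⟨w, 𝔔, τ', hwv, hwuniq, -, h𝔔w, -, hτ', hresτ'⟩ :=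
    exists_place_inert_of_not_mem_range (F := ℚ) (M := K) (hK.1 ▸ Nat.prime_two) hHn
      (hHi.trans rfl) hunr h𝔓₀ hI hγ hΦH
  rw [hK.1, sq_eq_absGaloisRestrict_conjGal_mul hc₀ ht g] at hresτ'
  have hτ'eq : τ' = ht.conjGalCMH g * g := absGaloisRestrict_injective ℚ K hresτ'
  have hℓw : (ℓ : 𝓞 K) ∈ w.asIdeal := by
    have h1 : (ℓ : 𝓞 ℚ) ∈ (w.under (𝓞 ℚ)).asIdeal := by rw [hwv]; exact hℓv
    rw [HeightOneSpectrum.under_asIdeal, Ideal.under_def, Ideal.mem_comap, map_natCast] at h1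
    exact h1
  have hwuniq' : ∀ w' : HeightOneSpectrum (𝓞 K), (ℓ : 𝓞 K) ∈ w'.asIdeal → w' = w := by
    intro w' hw'
    apply hwuniq
    apply HeightOneSpectrum.eq_of_natCast_mem_rat hℓ _ hℓv
    rw [HeightOneSpectrum.under_asIdeal, Ideal.under_def, Ideal.mem_comap, map_natCast]
    exact hw'
  have hspan : Ideal.span {(ℓ : 𝓞 K)} = w.asIdeal := by
    apply span_natCast_eq_of_unique hℓ w hwuniq'
    haveI : w.asIdeal.LiesOver v.asIdeal := ⟨by rw [← hwv]; rfl⟩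
    have hmap : v.asIdeal.map (algebraMap (𝓞 ℚ) (𝓞 K)) = Ideal.span {(ℓ : 𝓞 K)} := by
      rw [← span_natCast_rat_eq hℓ hℓv, Ideal.map_span, Set.image_singleton, map_natCast]
    have hne : v.asIdeal.map (algebraMap (𝓞 ℚ) (𝓞 K)) ≠ ⊥ := by
      rw [hmap, Ne, Ideal.span_singleton_eq_bot]; exact_mod_cast hℓ.ne_zero
    rw [← hmap, ← Ideal.IsDedekindDomain.ramificationIdx_eq_normalizedFactors_count v.asIdeal
      w.asIdeal hne]
    exact Ideal.ramificationIdx_eq_one_iff.mpr (hunr w.asIdeal w.isPrime inferInstance)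
  -- ### Step G: the value of the cocycle at `τ'`
  have hξm : ξ m = 0 := by
    have h := hm.2 0
    simp only [Matrix.cons_val_zero] at h
    exact h
  have hξs : ξ s = y := by
    rw [hs, hcoc, hρy, hξm, smul_zero, add_zero]
  have hBT : ht.conjGalCMH s ∈ torsionFixing (W.baseChange K) ((3 : ℕ) : ℤ) :=
    ht.conjGalCMH_mem_torsionFixing W hinv _ hsT
  have hξcs : ξ (ht.conjGalCMH s) = ν • T y := by
    have hcm : ht.conjGalCMH m ∈ 𝒩 :=
      ht.conjGalCMH_mem_evalKer W hinv _ (xs := ![x]) (ν := fun _ ↦ ν) (fun _ ↦ hν)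
        (fun i ↦ by fin_cases i; simpa using hxν) hm
    have hcs : ht.conjGalCMH s = ht.conjGalCMH ρ * ht.conjGalCMH m := by
      change ht.conjGalHom (ρ * m) = ht.conjGalHom ρ * ht.conjGalHom m
      exact map_mul _ _ _
    have h1 : ξ (ht.conjGalCMH ρ) = ν • T (ξ ρ) := ht.h1Eval_conjGalCMH_of_eigen W hinv _ hν hxν hρT
    have h2 : ξ (ht.conjGalCMH m) = 0 := by
      have h := hcm.2 0
      simp only [Matrix.cons_val_zero] at h
      exact h
    rw [hcs, hcoc, smul_eq_of_mem_torsionFixing _ _ (ht.conjGalCMH_mem_torsionFixing W hinv _ hρT), h1, h2,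
      add_zero, hρy]
  have hcg : ht.conjGalCMH g = ht.conjGalCMH g₁ * ht.conjGalCMH s := by
    change ht.conjGalHom (g₁ * s) = ht.conjGalHom g₁ * ht.conjGalHom s
    exact map_mul _ _ _
  have hAZ : ht.conjGalCMH g₁ • (ν • T y + g₁ • y) = y + y + (N' y + N' y + N' y) := by
    rw [hconj, map_add, map_zsmul, hTT, smul_add, smul_comm g₁ ν y, map_add, map_zsmul, hA2, hG,
      smul_smul, hνν, one_smul]
    abel
  have hξτ' : ξ τ' = Q₁ := by
    -- `ξ(conj(g₁) conj(s) g₁ s) = κ₀ + conj(g₁) • (ν T y + g₁ y) = κ₀ − y`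
    rw [hτ'eq, hcg, hg, hcoc, hcoc, hcoc, hξs, hξcs,
      mul_smul (ht.conjGalCMH g₁) (ht.conjGalCMH s) (ξ g₁ + g₁ • y), smul_eq_of_mem_torsionFixing _ _ hBT]
    have e1 : ξ (ht.conjGalCMH g₁) + ht.conjGalCMH g₁ • ν • T y + ht.conjGalCMH g₁ • (ξ g₁ + g₁ • y) =
        κ₀ + ht.conjGalCMH g₁ • (ν • T y + g₁ • y) := by
      rw [← hκ₀, hcoc, smul_add, smul_add]; abel
    rw [e1, hAZ]
    have e2 : κ₀ + (y + y + (N' y + N' y + N' y)) = Q₁ + (3 : ℤ) • (κ₀ - Q₁ + N' y) := by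
      rw [← hy]; module
    rw [e2, h3tor, add_zero]
  -- the action of `τ'` on `E(K̄)[3]`
  have hτ'M : ∀ M : geomTorsion (W.baseChange K) ((3 : ℕ) : ℤ), τ' • M = M + N' M + N' M := fun M ↦ by
    rw [hτ'eq, hcg, hg]
    simp only [mul_smul, smul_eq_of_mem_torsionFixing _ _ hsT, smul_eq_of_mem_torsionFixing _ _ hBT]
    rw [hconj, hA2]
  have hnot : ¬ ∃ M : geomTorsion (W.baseChange K) ((3 : ℕ) : ℤ), ξ τ' = τ' • M - M := by
    rintro ⟨M, hM⟩
    rw [hξτ', hτ'M, show M + N' M + N' M - M = N' M + N' M by abel] at hM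
    apply hQ₁
    rw [hM, map_add, hN'N', add_zero]
  -- `γ = c₀ · res g` acts on `E(ℚ̄)[3]` as `ν (1 + N')` (through `θ`)
  have hact : ∀ P : geomTorsion W ((3 : ℕ) : ℤ),
      θ ((c₀ * absGaloisRestrict ℚ K g) • P) = ν • (θ P + N' (θ P)) := fun P ↦ by
    have hresg : absGaloisRestrict ℚ K g = absGaloisRestrict ℚ K g₁ * absGaloisRestrict ℚ K s := by
      change absGaloisRestrict ℚ K (g₁ * s) = _
      exact map_mul _ _ _
    rw [hresg, ← mul_assoc, mul_smul (c₀ * absGaloisRestrict ℚ K g₁) (absGaloisRestrict ℚ K s) P,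
      absGaloisRestrict_smul_eq_of_mem_torsionFixing W hsT]
    exact hγ₁ P
  have hmod := mod_three_and_trace_of_frob W hℓ3' hgoodℓ hvℓ h𝔓₀ hγ θ N' hN'N' ⟨Q₁, hQ₁⟩ hν hact
  -- ### Step H: assemble
  refine ⟨ℓ, hℓB₀, ⟨hℓ, hℓN', hℓD', hℓ3', hspan ▸ w.isPrime, hmod.1, hmod.2⟩, ?_, w, hℓw, fun hxker ↦ ?_⟩
  · -- `Frob_ℓ² ≠ 1` on `E[3]`: `γ² = 1 + 2N' ≠ 1`
    refine ⟨v, 𝔓₀, c₀ * absGaloisRestrict ℚ K g, hℓv, h𝔓₀, hγ, θ.symm Q₁, fun h2 ↦ hQ₁ ?_⟩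
    have h' := congrArg θ h2
    rw [hact, hact, θ.apply_symm_apply, map_zsmul, map_add, hN'N', add_zero, smul_add, smul_smul, hνν, one_smul,
      smul_smul, hνν, one_smul, add_assoc, add_eq_left] at h'
    have h3 := h3tor (N' Q₁)
    have e : (3 : ℤ) • N' Q₁ = N' Q₁ + (N' Q₁ + N' Q₁) := by module
    rwa [e, h', add_zero] at h3
  · -- ### the local criterion at `w` (Gross Prop. 9.6 at the non-trivial Frobenius `δ τ' δ⁻¹`)
    haveI : CharZero (w.adicCompletion K) :=
      charZero_of_injective_algebraMap (algebraMap K (w.adicCompletion K)).injective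
    obtain ⟨𝔐, h𝔐⟩ := w.localPrimesAbove_nonempty
    set 𝔓w := w.primeBelow (closureEmb (K := K) (w.adicCompletion K)) 𝔐 with h𝔓w_def
    have h𝔓w : 𝔓w ∈ w.primesAbove := w.primeBelow_mem_primesAbove h𝔐
    haveI : 𝔓w.IsPrime := h𝔓w.1
    obtain ⟨δ, -, hF⟩ := HeightOneSpectrum.exists_isArithFrobAt_conj_of_mem_primesAbove_holds h𝔔w h𝔓w hτ'
    have hwbad : w ∉ (W.baseChange K).badPlaces (𝓞 K) := fun h ↦ hvS₃ ⟨w, Or.inl h, hwv⟩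
    have hwT : w ∉ Tx := fun h ↦ hvS₃ ⟨w, Or.inr h, hwv⟩
    have h3w : ((((3 : ℕ) : ℤ)) : 𝓞 K) ∉ w.asIdeal := by
      rw [Int.cast_natCast]
      exact not_natCast_mem_of_prime_ne hℓ Nat.prime_three hℓ3' w hℓw
    have hI : 𝔓w.inertia (absoluteGaloisGroup K) ≤ torsionFixing (W.baseChange K) ((3 : ℕ) : ℤ) :=
      inertia_le_torsionFixing (W.baseChange K) hwbad h3w _ h𝔐
    have hunrx : x ∈ unramifiedKer (geomTorsion (W.baseChange K) ((3 : ℕ) : ℤ)) 𝔓w := hTx w hwT 𝔓w h𝔓w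
    have hφI : ∀ i ∈ 𝔓w.inertia (absoluteGaloisGroup K), φ.1 i = 0 := by
      have hx' : oneCocycleClass _ φ ∈ unramifiedKer (geomTorsion (W.baseChange K) ((3 : ℕ) : ℤ)) 𝔓w := by
        rwa [hclass]
      obtain ⟨a, ha⟩ := (oneCocycleClass_mem_subgroupResKer_iff _ φ).mp hx'
      intro i hi
      rw [ha ⟨i, hi⟩, Subgroup.coe_mk, smul_eq_of_mem_torsionFixing (W.baseChange K) _ (hI hi), sub_self]
    have hcrit := LocalFrob.oneCocycleClass_mem_torsionLocalKer_iff_apply_frob (W.baseChange K) (n := 3)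
      (by norm_num) h𝔐 hF hI φ hφI
    rw [hclass] at hcrit
    obtain ⟨m', hm'⟩ := hcrit.mp hxker
    have hm'' : ξ (δ * τ' * δ⁻¹) = (δ * τ' * δ⁻¹) • m' - m' := hm'
    -- from `ξ(δ τ' δ⁻¹) = ∂m'` to `ξ(τ') = ∂M` with `M = δ⁻¹ (m' + ξ δ)`
    apply hnot
    refine ⟨δ⁻¹ • (m' + ξ δ), (smul_left_cancel_iff δ).mp ?_⟩
    have h1 : ξ (δ * τ' * δ⁻¹) = ξ δ + δ • ξ τ' - (δ * τ' * δ⁻¹) • ξ δ := by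
      rw [hcoc, hcoc, hξinv δ, smul_neg, mul_smul (δ * τ') δ⁻¹ (ξ δ)]
      abel
    rw [h1] at hm''
    have hR : δ • (τ' • (δ⁻¹ • (m' + ξ δ)) - δ⁻¹ • (m' + ξ δ)) =
        (δ * τ' * δ⁻¹) • (m' + ξ δ) - (m' + ξ δ) := by
      rw [smul_sub, smul_inv_smul, mul_smul (δ * τ') δ⁻¹ (m' + ξ δ), mul_smul δ τ' (δ⁻¹ • (m' + ξ δ))]
    have e : δ • ξ τ' = (ξ δ + δ • ξ τ' - (δ * τ' * δ⁻¹) • ξ δ) - ξ δ + (δ * τ' * δ⁻¹) • ξ δ := by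
      abel
    rw [hR, e, hm'', smul_add]
    abel

end Main

end Summit.BirchSwinnertonDyer.Rank1Residual.X11b.Three.Koly.Method2.Cheb

end
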